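import Literature.AlgebraicGeometry.Motives.ProjectiveSpaceFieldPointsBijective
import Literature.AlgebraicGeometry.Motives.SegreEmbedding
import HarnessLib

/-!
# The Segre embedding on homogeneous coordinates

For a field `k`, a field `L ⊇ k` and `n m : ℕ`, the Segre embedding
`segreEmbedding n m k : ℙⁿ_k ×ₖ ℙᵐ_k ⟶ ℙ^{nm+n+m}_k` of `Motives/SegreEmbedding` (glued from the
chart maps `z_{cd}/z_{ab} ↦ (x_c/x_a)(y_d/y_b)`) sends the pair of `L`-points with homogeneous
coordinates `z ∈ Lⁿ⁺¹ ∖ 0`, `w ∈ Lᵐ⁺¹ ∖ 0` (`ProjectiveSpace.pointOfVec`,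
`Motives/ProjectiveSpaceFieldPoints`) to the `L`-point with homogeneous coordinates
`z ⊗ w = (z_c w_d)_{(c,d)}` (`map_segreEmbedding_lift_pointOfVec`; Hartshorne, *Algebraic Geometry*,
I Ex. 2.14: "the map defined by sending `(a₀, …, a_r) × (b₀, …, b_s)` to `(…, aᵢbⱼ, …)` in
lexicographic order"; II Ex. 5.11). Consequences: every `L`-point of `ℙⁿ ×ₖ ℙᵐ` is such a pair
(`exists_eq_lift_pointOfVec`), and the Segre image of `([z], [w])` lies in the zero locus of a form
`G` iff `G(z ⊗ w) = 0` (`pt_map_segreEmbedding_mem_zeroLocus_iff`) — the dictionary by which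
bihomogeneous incidence equations on `ℙⁿ × ℙᵐ` are read off from forms on the Segre space (used for
incidence correspondences, e.g. the universal line over a Fano scheme of lines).

This file only adds theorems about existing objects.

## References

* R. Hartshorne, *Algebraic Geometry*, GTM 52 (1977): I Ex. 2.14, II Ex. 5.11, II Thm. 7.1.
  [Hartshorne1977]
-/

noncomputable section

open CategoryTheory AlgebraicGeometry Limits MonoidalCategory CartesianMonoidalCategory
  HomogeneousLocalization MvPolynomial

universe u

namespace Literature.AlgebraicGeometry.Motives

attribute [local instance] MvPolynomial.gradedAlgebra ProjBaseChange.algebraBase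

namespace ProjectiveSpace

variable {n m : ℕ} {k : Type u} [Field k] {L : Type u} [Field L] [Algebra k L]

/-! ### The vector `z ⊗ w` of Segre coordinates -/

/-- The `(a, b)` Segre coordinate of `z ⊗ w` is `z_a w_b`. [folklore] -/
theorem segreVec_apply (z : Fin (n + 1) → L) (w : Fin (m + 1) → L) (a : Fin (n + 1))
    (b : Fin (m + 1)) :
    (fun t => z ((segreIndexEquiv n m).symm t).1 * w ((segreIndexEquiv n m).symm t).2)
      (segreIndexEquiv n m (a, b)) = z a * w b := by
  simp

/-- `z ⊗ w ≠ 0` for `z ≠ 0`, `w ≠ 0` (`L` is a domain). [folklore] -/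
theorem segreVec_ne_zero {z : Fin (n + 1) → L} {w : Fin (m + 1) → L} (hz : z ≠ 0) (hw : w ≠ 0) :
    (fun t => z ((segreIndexEquiv n m).symm t).1 * w ((segreIndexEquiv n m).symm t).2) ≠ 0 := by
  obtain ⟨a, ha⟩ := Function.ne_iff.mp hz
  obtain ⟨b, hb⟩ := Function.ne_iff.mp hw
  rw [Function.ne_iff]
  exact ⟨segreIndexEquiv n m (a, b), by simpa using mul_ne_zero ha hb⟩

/-! ### Pulling back chart functions along an `L`-point of a standard chart -/

/-- Along `Spec (awayEval z) : Spec L → D₊(x_a)` the coordinate function `x_c/x_a` pulls back to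
`z_c / z_a`. [folklore] -/
theorem pull_specMap_awayEval_frac (z : Fin (n + 1) → L) (a : Fin (n + 1))
    (hza : aeval z (X a : MvPolynomial (Fin (n + 1)) k) ≠ 0) (c : Fin (n + 1)) :
    Segre.pull (Spec.map (CommRingCat.ofHom (awayEval z hza).toRingHom)) (Segre.frac k a c) =
      Segre.pull (𝟙 (Spec (.of L))) (z c / z a) := by
  rw [← Category.id_comp (Spec.map _), Segre.pull_SpecMap]
  congr 1
  change awayEval z hza (Segre.frac k a c) = z c / z a
  rw [Segre.frac, Away.isLocalizationElem, awayEval_mk z hza (Segre.X_mem k a), pow_one, pow_one,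
    aeval_X, aeval_X]

/-- Along `Spec (awayEval z) : Spec L → D₊(x_a)` the constants pull back to constants. [folklore] -/
theorem pull_specMap_awayEval_comp_cst (z : Fin (n + 1) → L) (a : Fin (n + 1))
    (hza : aeval z (X a : MvPolynomial (Fin (n + 1)) k) ≠ 0) :
    (Segre.pull (Spec.map (CommRingCat.ofHom (awayEval z hza).toRingHom))).comp
        (Segre.cst k (X a)) =
      (Segre.pull (𝟙 (Spec (.of L)))).comp (algebraMap k L) := by
  ext c
  rw [RingHom.comp_apply, RingHom.comp_apply, ← Category.id_comp (Spec.map _), Segre.pull_SpecMap]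
  congr 1
  change awayEval z hza (algebraMap k _ c) = algebraMap k L c
  exact (awayEval z hza).commutes c

/-! ### The chart ring map of the Segre embedding at a pair of `L`-points -/

/-- **The Segre chart map at a pair of `L`-points is evaluation at `z ⊗ w`.** For the `L`-points
`Spec L → D₊(x_a)`, `Spec L → D₊(y_b)` with homogeneous coordinates `z` (`z_a ≠ 0`) and `w`
(`w_b ≠ 0`), the ring map `(k[z]_{(z_{ab})})₀ → Γ(Spec L, 𝒪)`, `z_{cd}/z_{ab} ↦ (x_c/x_a)(y_d/y_b)`
of `Motives/SegreEmbedding` (`Segre.segreRingHom`) is the pull-back along the `L`-point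
`Spec L → D₊(z_{ab})` with homogeneous coordinates `z ⊗ w`: both send `q/z_{ab}^N` (`q` a form of
degree `N`) to `q(z ⊗ w)/(z_a w_b)^N`, by homogeneity. [cite: Hartshorne1977, II Ex. 5.11] -/
theorem segreRingHom_specMap_awayEval (z : Fin (n + 1) → L) (w : Fin (m + 1) → L)
    (a : Fin (n + 1)) (b : Fin (m + 1))
    (hza : aeval z (X a : MvPolynomial (Fin (n + 1)) k) ≠ 0)
    (hwb : aeval w (X b : MvPolynomial (Fin (m + 1)) k) ≠ 0)
    (hv : aeval (fun t => z ((segreIndexEquiv n m).symm t).1 * w ((segreIndexEquiv n m).symm t).2)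
      (X (segreIndexEquiv n m (a, b)) : MvPolynomial (Fin (n * m + n + m + 1)) k) ≠ 0) :
    Segre.segreRingHom (segreIndexEquiv n m) a b
        (Spec.map (CommRingCat.ofHom (awayEval z hza).toRingHom))
        (Spec.map (CommRingCat.ofHom (awayEval w hwb).toRingHom)) =
      Segre.pull (Spec.map (CommRingCat.ofHom (awayEval
        (fun t => z ((segreIndexEquiv n m).symm t).1 * w ((segreIndexEquiv n m).symm t).2)
        hv).toRingHom)) := by
  set e := segreIndexEquiv n m with he
  set v : Fin (n * m + n + m + 1) → L := fun t => z (e.symm t).1 * w (e.symm t).2 with hvdef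
  have hza' : z a ≠ 0 := by rwa [aeval_X] at hza
  have hwb' : w b ≠ 0 := by rwa [aeval_X] at hwb
  refine RingHom.ext fun s => ?_
  obtain ⟨N, q, hq, rfl⟩ :=
    Away.mk_surjective (Segre.grading (Fin (n * m + n + m + 1)) k) (Segre.X_mem k (e (a, b))) s
  rw [Segre.segreRingHom_awayMk, ← Category.id_comp (Spec.map (CommRingCat.ofHom
    (awayEval v hv).toRingHom)), Segre.pull_SpecMap]
  change _ = Segre.pull (𝟙 (Spec (.of L)))
    (awayEval v hv (Away.mk _ (Segre.X_mem k (e (a, b))) N q hq))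
  rw [awayEval_mk v hv (Segre.X_mem k (e (a, b))), Segre.segreFun, MvPolynomial.coe_eval₂Hom,
    pull_specMap_awayEval_comp_cst]
  have hfun : (fun t => Segre.pull (Spec.map (CommRingCat.ofHom (awayEval z hza).toRingHom))
        (Segre.frac k a (e.symm t).1) *
      Segre.pull (Spec.map (CommRingCat.ofHom (awayEval w hwb).toRingHom))
        (Segre.frac k b (e.symm t).2)) =
      ⇑(Segre.pull (𝟙 (Spec (.of L)))) ∘ fun t => (z a * w b)⁻¹ * v t := by
    funext t
    rw [Function.comp_apply, pull_specMap_awayEval_frac, pull_specMap_awayEval_frac, ← map_mul]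
    congr 1
    rw [hvdef]
    field_simp
  rw [hfun, ← MvPolynomial.eval₂_comp_left]
  congr 1
  have hq' : q.IsHomogeneous N := by simpa using hq
  rw [Segre.eval₂_mul_left_of_isHomogeneous _ _ _ hq', aeval_X, ← MvPolynomial.aeval_def]
  have hvab : v (e (a, b)) = z a * w b := by simp [hvdef]
  rw [hvab, inv_pow, div_eq_mul_inv, mul_comm]

/-! ### The Segre embedding on homogeneous coordinates -/

/-- **The Segre embedding on homogeneous coordinates**: the pair of `L`-points `([z], [w])` of
`ℙⁿ_k ×ₖ ℙᵐ_k` maps to the `L`-point `[z ⊗ w] = (… : z_c w_d : …)` of `ℙ^{nm+n+m}_k` (coordinates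
in the lexicographic order `segreIndexEquiv`). Proof: `([z], [w])` factors through the chart
`D₊(x_a) ×ₖ D₊(y_b)` (`z_a, w_b ≠ 0`) on which the Segre map is `Spec` of
`z_{cd}/z_{ab} ↦ (x_c/x_a)(y_d/y_b)`, and at `([z], [w])` that ring map is evaluation at `z ⊗ w`
(`segreRingHom_specMap_awayEval`). [cite: Hartshorne1977, I Ex. 2.14 and II Ex. 5.11] -/
theorem map_segreEmbedding_lift_pointOfVec (z : Fin (n + 1) → L) (hz : z ≠ 0)
    (w : Fin (m + 1) → L) (hw : w ≠ 0) :
    AlgPoints.map (segreEmbedding n m k) (lift (pointOfVec k z hz) (pointOfVec k w hw)) =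
      pointOfVec k
        (fun t => z ((segreIndexEquiv n m).symm t).1 * w ((segreIndexEquiv n m).symm t).2)
        (segreVec_ne_zero hz hw) := by
  obtain ⟨a, hza'⟩ := Function.ne_iff.mp hz
  obtain ⟨b, hwb'⟩ := Function.ne_iff.mp hw
  have hza : aeval z (X a : MvPolynomial (Fin (n + 1)) k) ≠ 0 := by rwa [aeval_X]
  have hwb : aeval w (X b : MvPolynomial (Fin (m + 1)) k) ≠ 0 := by rwa [aeval_X]
  have hv : aeval (fun t => z ((segreIndexEquiv n m).symm t).1 * w ((segreIndexEquiv n m).symm t).2)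
      (X (segreIndexEquiv n m (a, b)) : MvPolynomial (Fin (n * m + n + m + 1)) k) ≠ 0 := by
    rw [aeval_X]
    simpa using mul_ne_zero hza' hwb'
  -- the two `L`-points through the charts `D₊(x_a)`, `D₊(y_b)`
  set α : Spec (.of L) ⟶ Spec (.of (Away (Segre.grading (Fin (n + 1)) k) (X a))) :=
    Spec.map (CommRingCat.ofHom (awayEval z hza).toRingHom) with hα
  set β : Spec (.of L) ⟶ Spec (.of (Away (Segre.grading (Fin (m + 1)) k) (X b))) :=
    Spec.map (CommRingCat.ofHom (awayEval w hwb).toRingHom) with hβ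
  have hP : (pointOfVec k z hz).left = α ≫ Segre.chartι k a := by
    rw [pointOfVec_eq_chartPoint z hz (X_mem a) one_pos hza, chartPoint_left]
  have hQ : (pointOfVec k w hw).left = β ≫ Segre.chartι k b := by
    rw [pointOfVec_eq_chartPoint w hw (X_mem b) one_pos hwb, chartPoint_left]
  -- the pair `([z], [w])` as a morphism to `ℙⁿ ×ₖ ℙᵐ = pullback toSpec toSpec`
  have H' : (pointOfVec k z hz).left ≫ Segre.toSpec (Fin (n + 1)) k =
      (pointOfVec k w hw).left ≫ Segre.toSpec (Fin (m + 1)) k :=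
    (Over.w (pointOfVec k z hz)).trans (Over.w (pointOfVec k w hw)).symm
  have hαβ : α ≫ Segre.chartι k a ≫ Segre.toSpec (Fin (n + 1)) k =
      β ≫ Segre.chartι k b ≫ Segre.toSpec (Fin (m + 1)) k := by
    have h1 : (α ≫ Segre.chartι k a) ≫ Segre.toSpec (Fin (n + 1)) k =
        (β ≫ Segre.chartι k b) ≫ Segre.toSpec (Fin (m + 1)) k := by
      rw [← hP, ← hQ]
      exact H'
    exact ((Category.assoc _ _ _).symm.trans h1).trans (Category.assoc _ _ _)
  -- `([z], [w])` factors through the chart `D₊(x_a) ×ₖ D₊(y_b)` of the product cover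
  have hfac : pullback.lift α β hαβ ≫ (Segre.prodCover (Fin (n + 1)) (Fin (m + 1)) k).f (a, b) =
      pullback.lift (f := Segre.toSpec (Fin (n + 1)) k) (g := Segre.toSpec (Fin (m + 1)) k)
        (pointOfVec k z hz).left (pointOfVec k w hw).left H' := by
    apply pullback.hom_ext
    · rw [Category.assoc, Segre.prodCover_f_fst, Segre.chartFst, pullback.lift_fst_assoc]
      exact ((pullback.lift_fst _ _ _).trans hP).symm
    · rw [Category.assoc, Segre.prodCover_f_snd, Segre.chartSnd, pullback.lift_snd_assoc]
      exact ((pullback.lift_snd _ _ _).trans hQ).symm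
  have hfac₂ : pullback.lift (f := Segre.toSpec (Fin (n + 1)) k) (g := Segre.toSpec (Fin (m + 1)) k)
        (pointOfVec k z hz).left (pointOfVec k w hw).left H' ≫ Segre.segre k (segreIndexEquiv n m) =
      pullback.lift α β hαβ ≫ Segre.segreChart k (segreIndexEquiv n m) (a, b) := by
    rw [← Segre.prodCover_f_segre, ← Category.assoc, hfac]
    rfl
  ext : 1
  change pullback.lift (f := Segre.toSpec (Fin (n + 1)) k) (g := Segre.toSpec (Fin (m + 1)) k)
      (pointOfVec k z hz).left (pointOfVec k w hw).left H' ≫ Segre.segre k (segreIndexEquiv n m) =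
    (pointOfVec k _ (segreVec_ne_zero hz hw)).left
  rw [hfac₂]
  change pullback.lift α β hαβ ≫
    Segre.segreMap (segreIndexEquiv n m) a b (Segre.chartFst k (a, b)) (Segre.chartSnd k (a, b)) = _
  rw [Segre.comp_segreMap, Segre.chartFst, Segre.chartSnd, pullback.lift_fst, pullback.lift_snd,
    pointOfVec_eq_chartPoint _ _ (X_mem (segreIndexEquiv n m (a, b))) one_pos hv, chartPoint_left]
  change (Spec (.of L)).toSpecΓ ≫ Spec.map (CommRingCat.ofHom (Segre.segreRingHom (segreIndexEquiv n m) a b α β)) ≫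
    Segre.chartι k (segreIndexEquiv n m (a, b)) = _
  rw [hα, hβ, segreRingHom_specMap_awayEval z w a b hza hwb hv]
  exact Segre.toSpecΓ_SpecMap_pull_assoc _ _

/-- **Every `L`-point of `ℙⁿ_k ×ₖ ℙᵐ_k` is a pair `([z], [w])`** of points with homogeneous
coordinates (`exists_eq_pointOfVec` on the two projections, and the universal property of the
fibre product, `AlgPoints.prodEquiv`). [folklore] -/
theorem exists_eq_lift_pointOfVec (P : AlgPoints (projectiveSpace n k ⊗ projectiveSpace m k) L) :
    ∃ (z : Fin (n + 1) → L) (hz : z ≠ 0) (w : Fin (m + 1) → L) (hw : w ≠ 0),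
      P = lift (pointOfVec k z hz) (pointOfVec k w hw) := by
  obtain ⟨z, hz, h₁⟩ := exists_eq_pointOfVec (AlgPoints.map (fst _ _) P)
  obtain ⟨w, hw, h₂⟩ := exists_eq_pointOfVec (AlgPoints.map (snd _ _) P)
  refine ⟨z, hz, w, hw, ?_⟩
  rw [← h₁, ← h₂]
  exact (AlgPoints.prodEquiv.symm_apply_apply P).symm

/-- **Zero loci under the Segre embedding**: the Segre image of `([z], [w])` lies in `V₊(G)`, `G` a
form of positive degree on `ℙ^{nm+n+m}`, iff `G(z ⊗ w) = 0` — i.e. iff the bihomogeneous form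
`G(…, x_c y_d, …)` vanishes at `(z, w)`. [cite: Hartshorne1977, II Ex. 5.11] -/
theorem pt_map_segreEmbedding_lift_mem_zeroLocus_iff (z : Fin (n + 1) → L) (hz : z ≠ 0)
    (w : Fin (m + 1) → L) (hw : w ≠ 0) {d : ℕ} (hd : 0 < d)
    {G : MvPolynomial (Fin (n * m + n + m + 1)) k}
    (hG : G ∈ MvPolynomial.homogeneousSubmodule (Fin (n * m + n + m + 1)) k d) :
    (AlgPoints.map (segreEmbedding n m k) (lift (pointOfVec k z hz) (pointOfVec k w hw))).pt ∈
        ProjectiveSpectrum.zeroLocus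
          (MvPolynomial.homogeneousSubmodule (Fin (n * m + n + m + 1)) k) {G} ↔
      aeval (fun t => z ((segreIndexEquiv n m).symm t).1 * w ((segreIndexEquiv n m).symm t).2)
        G = 0 := by
  rw [map_segreEmbedding_lift_pointOfVec]
  exact pt_pointOfVec_mem_zeroLocus_iff _ _ hd hG

/-- **Basic opens under the Segre embedding**: the Segre image of `([z], [w])` lies in `D₊(G)` iff
`G(z ⊗ w) ≠ 0`. [cite: Hartshorne1977, II Ex. 5.11] -/
theorem pt_map_segreEmbedding_lift_mem_basicOpen_iff (z : Fin (n + 1) → L) (hz : z ≠ 0)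
    (w : Fin (m + 1) → L) (hw : w ≠ 0) {d : ℕ} (hd : 0 < d)
    {G : MvPolynomial (Fin (n * m + n + m + 1)) k}
    (hG : G ∈ MvPolynomial.homogeneousSubmodule (Fin (n * m + n + m + 1)) k d) :
    (AlgPoints.map (segreEmbedding n m k) (lift (pointOfVec k z hz) (pointOfVec k w hw))).pt ∈
        Proj.basicOpen (MvPolynomial.homogeneousSubmodule (Fin (n * m + n + m + 1)) k) G ↔
      aeval (fun t => z ((segreIndexEquiv n m).symm t).1 * w ((segreIndexEquiv n m).symm t).2)
        G ≠ 0 := by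
  rw [map_segreEmbedding_lift_pointOfVec]
  exact pt_pointOfVec_mem_basicOpen_iff _ _ hd hG

end ProjectiveSpace

end Literature.AlgebraicGeometry.Motives
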